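import Literature.NumberTheory.Transcendental.ComplexFormsProofs
import HarnessLib

/-!
# `ℂ`-multilinear complex forms: the pointwise meaning of type `(k,0)`

Companion to `ComplexForms` (types `IsOfType p q` of complex forms via the weights of the
rotations `e^{iθ}` of the tangent space). A complex `k`-form `α` on a complex manifold is
**`ℂ`-multilinear** (`IsComplexLinearForm α`) if at every point it is `ℂ`-linear in each tangent
vector separately — the pointwise condition of being a section of
`Λ^{k,0}T^*M = Λ^k T^{*1,0}` (Huybrechts (2005), Def. 1.2.7 / Prop. 1.2.8). Main results:

* `IsComplexLinearForm.isOfType`: a `ℂ`-multilinear `k`-form has type `(k,0)` (weight `k`);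
* `IsOfType.isComplexLinearForm`: conversely **a form of type `(k,0)` is `ℂ`-multilinear**
  (Huybrechts, Prop. 1.2.8 (ii): the weight-`k` part of `Λ^k V*_ℂ = ⨁_{p+q=k} Λ^{p,q}` is
  `Λ^{k,0}`), proved for `ℝ`-multilinear maps of diagonal weight equal to the number of variables
  (`map_update_smul_of_hasDiagWeight`) by induction on the number of variables:
  split the first variable into its `ℂ`-linear and conjugate-linear parts; the former has weight
  `k - 1` in the remaining `k - 1` variables, the latter weight `k + 1`, which forces it to vanish
  because an `ℝ`-multilinear map in `n` vector variables is a trigonometric polynomial of degree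
  `≤ n` along rotating frames (`exists_fourier_multilinear` of `ComplexFormsProofs`, and
  character orthogonality `sum_exp_mul_rootAngle_mul_I_eq_zero`).

So `IsOfType k 0 α ↔ IsComplexLinearForm α` (`isOfType_zero_iff_isComplexLinearForm`): the
tree's weight encoding of "holomorphic type" and the classical one agree. No dimension hypothesis
and no alternation is needed.

## Design notes

* `IsComplexLinearForm` is stated with the real-linear map `tangentSMul x c` = multiplication by
  `c ∈ ℂ` on `T_x M = E` (same device as `tangentRotate`; the synonym `TangentSpace` carries no
  `Module ℂ` instance).
* `HasDiagWeight w φ` is the diagonal-rotation weight condition for a bare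
  `ℝ`-multilinear map (the pointwise content of `IsOfType p q` with `w = p - q`).

## References

* D. Huybrechts, *Complex Geometry* (2005), Def. 1.2.7, Prop. 1.2.8.
* C. Voisin, *Hodge Theory and Complex Algebraic Geometry I* (2002), §2.3.1.
-/

noncomputable section

open scoped Manifold ContDiff
open Literature.Geometry.Kaehler

namespace Literature.NumberTheory.Transcendental

universe u v

section ComplexLinear

variable {E : Type u} [NormedAddCommGroup E] [NormedSpace ℂ E]
  {M : Type v} [TopologicalSpace M] [ChartedSpace E M] {k : ℕ}

variable (E) in
/-- Multiplication by the complex scalar `c` on the real tangent space `T_x M = E` of a complex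
manifold, as a real continuous linear map (`tangentRotate E x θ = tangentSMul E x (e^{iθ})`).
Huybrechts (2005), §1.2 (the complex structure `I` on `V`). [cite: HuybrechtsCG2005, §1.2] -/
def tangentSMul (x : M) (c : ℂ) : TangentSpace 𝓘(ℝ, E) x →L[ℝ] TangentSpace 𝓘(ℝ, E) x :=
  ((c • ContinuousLinearMap.id ℂ E).restrictScalars ℝ : E →L[ℝ] E)

/-- `tangentSMul E x c v = c • v`, the scalar action being that of `E = TangentSpace 𝓘(ℝ, E) x`.
[folklore] -/
theorem tangentSMul_apply (x : M) (c : ℂ) (v : TangentSpace 𝓘(ℝ, E) x) :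
    tangentSMul E x c v = (letI V : E := v; c • V) :=
  rfl

/-- Rotation by `e^{iθ}` is multiplication by the scalar `e^{iθ}`. [folklore] -/
theorem tangentRotate_eq_tangentSMul (x : M) (θ : ℝ) :
    tangentRotate E x θ = tangentSMul E x (Complex.exp (θ * Complex.I)) :=
  rfl

/-- `tangentSMul` is multiplicative in the scalar. [folklore] -/
theorem tangentSMul_mul_apply (x : M) (c c' : ℂ) (v : TangentSpace 𝓘(ℝ, E) x) :
    tangentSMul E x (c * c') v = tangentSMul E x c (tangentSMul E x c' v) := by
  simp only [tangentSMul_apply]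
  exact mul_smul c c' (show E from v)

/-- `tangentSMul E x 1` is the identity. [folklore] -/
@[simp]
theorem tangentSMul_one_apply (x : M) (v : TangentSpace 𝓘(ℝ, E) x) : tangentSMul E x 1 v = v := by
  simp only [tangentSMul_apply]
  exact one_smul ℂ (show E from v)

/-- A complex `k`-form is **`ℂ`-multilinear** if at every point it is `ℂ`-linear in each tangent
vector separately: `α(v₁, …, c vⱼ, …, v_k) = c α(v₁, …, v_k)`. This is the pointwise condition of
being a section of `Λ^{k,0} T^*M = Λ^k T^{*1,0}` (Huybrechts (2005), Def. 1.2.7 and Prop. 1.2.8: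
`Λ^{k,0} V` consists of the `ℂ`-multilinear alternating forms); it implies `IsOfType k 0`
(`IsComplexLinearForm.isOfType`). A holomorphic `k`-form is a closed smooth `ℂ`-multilinear form.
[cite: HuybrechtsCG2005, Def. 1.2.7] -/
def IsComplexLinearForm (α : MForm 𝓘(ℝ, E) M ℂ k) : Prop :=
  ∀ (x : M) (v : Fin k → TangentSpace 𝓘(ℝ, E) x) (j : Fin k) (c : ℂ),
    α x (Function.update v j (tangentSMul E x c (v j))) = c * α x v

/-- The zero form is `ℂ`-multilinear. [folklore] -/
theorem isComplexLinearForm_zero : IsComplexLinearForm (0 : MForm 𝓘(ℝ, E) M ℂ k) :=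
  fun _ _ _ _ ↦ by simp

/-- `ℂ`-multilinear forms are stable under complex scalars. [folklore] -/
theorem IsComplexLinearForm.smul (c : ℂ) {α : MForm 𝓘(ℝ, E) M ℂ k} (hα : IsComplexLinearForm α) :
    IsComplexLinearForm (c • α) := fun x v j c' ↦ by
  simp only [Pi.smul_apply, ContinuousAlternatingMap.smul_apply, hα x v j c', smul_eq_mul]
  ring

/-- `ℂ`-multilinear forms are stable under addition. [folklore] -/
theorem IsComplexLinearForm.add {α β : MForm 𝓘(ℝ, E) M ℂ k} (hα : IsComplexLinearForm α)
    (hβ : IsComplexLinearForm β) : IsComplexLinearForm (α + β) := fun x v j c ↦ by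
  simp only [Pi.add_apply, ContinuousAlternatingMap.add_apply, hα x v j c, hβ x v j c, mul_add]

/-- A `ℂ`-multilinear form scales by `c^{#s}` when the vectors indexed by `s` are multiplied by `c`.
[folklore] -/
theorem IsComplexLinearForm.apply_piecewise_smul {α : MForm 𝓘(ℝ, E) M ℂ k} (hα : IsComplexLinearForm α)
    (x : M) (c : ℂ) (v : Fin k → TangentSpace 𝓘(ℝ, E) x) (s : Finset (Fin k)) :
    α x (fun i ↦ if i ∈ s then tangentSMul E x c (v i) else v i) = c ^ s.card * α x v := by
  classical
  induction s using Finset.induction_on with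
  | empty => simp
  | insert j s hj ih =>
    have hupd : (fun i ↦ if i ∈ insert j s then tangentSMul E x c (v i) else v i) =
        Function.update (fun i ↦ if i ∈ s then tangentSMul E x c (v i) else v i) j
          (tangentSMul E x c ((fun i ↦ if i ∈ s then tangentSMul E x c (v i) else v i) j)) := by
      funext i
      by_cases hij : i = j
      · subst hij
        simp [hj]
      · simp [hij]
    rw [hupd, hα, ih, Finset.card_insert_of_notMem hj, pow_succ]
    ring

/-- A `ℂ`-multilinear `k`-form is of type `(k,0)`: `α(e^{iθ}v) = e^{ikθ} α(v)`
(Huybrechts (2005), Prop. 1.2.8). [cite: HuybrechtsCG2005, Prop. 1.2.8] -/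
theorem IsComplexLinearForm.isOfType {α : MForm 𝓘(ℝ, E) M ℂ k} (hα : IsComplexLinearForm α) :
    IsOfType k 0 α := by
  refine ⟨by simp, fun x θ v ↦ ?_⟩
  have h := hα.apply_piecewise_smul x (Complex.exp (θ * Complex.I)) v Finset.univ
  simp only [Finset.mem_univ, if_true, Finset.card_univ, Fintype.card_fin] at h
  rw [tangentRotate_eq_tangentSMul, h, ← Complex.exp_nat_mul]
  congr 2
  push_cast
  ring

end ComplexLinear

/-! ### Weights of bare multilinear maps; vanishing above the degree -/

section Weight

variable {E : Type u} [NormedAddCommGroup E] [NormedSpace ℂ E] {n : ℕ}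

/-- An `ℝ`-multilinear complex-valued map in `n` vector variables has **diagonal weight `w`** if
`φ(e^{iθ}v₁, …, e^{iθ}vₙ) = e^{iwθ} φ(v₁, …, vₙ)` for all `θ` (the pointwise content of
`IsOfType p q`, `w = p - q`). [cite: HuybrechtsCG2005, Prop. 1.2.8] -/
def HasDiagWeight (w : ℤ) (φ : MultilinearMap ℝ (fun _ : Fin n ↦ E) ℂ) : Prop :=
  ∀ (θ : ℝ) (v : Fin n → E),
    φ (fun i ↦ Complex.exp (θ * Complex.I) • v i) = Complex.exp (w * θ * Complex.I) * φ v

/-- **No weight beyond the degree**: an `ℝ`-multilinear map in `n` vector variables of diagonal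
weight `w` with `|w| > n` vanishes (along a rotating frame it is a trigonometric polynomial of
degree `≤ n`, `exists_fourier_multilinear`, and characters are orthogonal).
[cite: HuybrechtsCG2005, Prop. 1.2.8] -/
theorem eq_zero_of_hasDiagWeight_of_lt {w : ℤ}
    {φ : MultilinearMap ℝ (fun _ : Fin n ↦ E) ℂ} (hφ : HasDiagWeight w φ)
    (hw : n < w.natAbs) : φ = 0 := by
  ext v
  obtain ⟨P, hP, hθ⟩ := exists_fourier_multilinear n φ v
  -- average `e^{-iwθ} φ(e^{iθ}v)` over the `(2k+1)`-st roots of unity, `k = n + |w|`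
  set k : ℕ := n + w.natAbs with hk
  set θj : Fin (2 * k + 1) → ℝ := fun j ↦ 2 * Real.pi * j / (2 * k + 1) with hθj
  have hsum : ∑ j : Fin (2 * k + 1), Complex.exp (-(w * θj j * Complex.I)) *
      φ (fun i ↦ Complex.exp (θj j * Complex.I) • v i) = (2 * k + 1 : ℕ) * φ v := by
    have : ∀ j, Complex.exp (-(w * θj j * Complex.I)) *
        φ (fun i ↦ Complex.exp (θj j * Complex.I) • v i) = φ v := by
      intro j
      rw [hφ, ← mul_assoc, ← Complex.exp_add, neg_add_cancel, Complex.exp_zero, one_mul]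
    simp [this]
  have hsum' : ∑ j : Fin (2 * k + 1), Complex.exp (-(w * θj j * Complex.I)) *
      φ (fun i ↦ Complex.exp (θj j * Complex.I) • v i) = 0 := by
    simp_rw [hθ, Finset.mul_sum]
    rw [Finset.sum_comm]
    refine Finset.sum_eq_zero fun m hm ↦ ?_
    have hmn := hP m hm
    have hd : m - w ≠ 0 := by omega
    have hdk : (m - w).natAbs ≤ 2 * k := by omega
    have h0 := sum_exp_mul_rootAngle_mul_I_eq_zero (k := k) hd hdk
    have : ∀ j : Fin (2 * k + 1), Complex.exp (-(w * θj j * Complex.I)) *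
        (P.coeff m * Complex.exp (m * θj j * Complex.I)) =
        P.coeff m * Complex.exp (((m - w : ℤ) : ℂ) * ((2 * Real.pi * j / (2 * k + 1) : ℝ) : ℂ) *
          Complex.I) := by
      intro j
      rw [mul_left_comm, ← Complex.exp_add]
      congr 2
      simp only [hθj]
      push_cast
      ring
    rw [Finset.sum_congr rfl fun j _ ↦ this j, ← Finset.mul_sum, h0, mul_zero]
  rw [hsum'] at hsum
  have hN : ((2 * k + 1 : ℕ) : ℂ) ≠ 0 := Nat.cast_ne_zero.2 (Nat.succ_ne_zero _)
  rw [zero_apply]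
  rcases mul_eq_zero.1 hsum.symm with h | h
  · exact absurd h hN
  · exact h

end Weight

/-! ### Type `(k,0)` is `ℂ`-multilinearity -/

section Bridge

variable {E : Type u} [NormedAddCommGroup E] [NormedSpace ℂ E] {n : ℕ}

/-- The `ℂ`-linear part in the first variable: `φ⁺(x) = ½ (φ(x, ·) - i φ(ix, ·))`. [folklore] -/
def holPart (φ : MultilinearMap ℝ (fun _ : Fin (n + 1) ↦ E) ℂ) (x : E) :
    MultilinearMap ℝ (fun _ : Fin n ↦ E) ℂ :=
  (2⁻¹ : ℂ) • (φ.curryLeft x - Complex.I • φ.curryLeft (Complex.I • x))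

/-- The conjugate-linear part in the first variable: `φ⁻(x) = ½ (φ(x, ·) + i φ(ix, ·))`.
[folklore] -/
def antiPart (φ : MultilinearMap ℝ (fun _ : Fin (n + 1) ↦ E) ℂ) (x : E) :
    MultilinearMap ℝ (fun _ : Fin n ↦ E) ℂ :=
  (2⁻¹ : ℂ) • (φ.curryLeft x + Complex.I • φ.curryLeft (Complex.I • x))

/-- `φ(x, ·) = φ⁺(x) + φ⁻(x)`. [folklore] -/
theorem holPart_add_antiPart (φ : MultilinearMap ℝ (fun _ : Fin (n + 1) ↦ E) ℂ)
    (x : E) : holPart φ x + antiPart φ x = φ.curryLeft x := by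
  ext w
  simp only [holPart, antiPart, add_apply, smul_apply, sub_apply, smul_eq_mul]
  ring

/-- `φ⁺` is additive in `x`. [folklore] -/
theorem holPart_add (φ : MultilinearMap ℝ (fun _ : Fin (n + 1) ↦ E) ℂ) (x y : E) :
    holPart φ (x + y) = holPart φ x + holPart φ y := by
  simp only [holPart, smul_add, map_add]
  ext w
  simp only [smul_apply, sub_apply, add_apply, smul_eq_mul]
  ring

/-- `φ⁺` commutes with real scalars in `x`. [folklore] -/
theorem holPart_smul_real (φ : MultilinearMap ℝ (fun _ : Fin (n + 1) ↦ E) ℂ)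
    (r : ℝ) (x : E) : holPart φ (r • x) = (r : ℂ) • holPart φ x := by
  ext w
  simp only [holPart, smul_apply, sub_apply, smul_eq_mul, smul_comm Complex.I r x,
    φ.curryLeft.map_smul, Complex.real_smul]
  ring

/-- `φ⁺` is `ℂ`-linear in `x`: `φ⁺(ix) = i φ⁺(x)`. [folklore] -/
theorem holPart_I_smul (φ : MultilinearMap ℝ (fun _ : Fin (n + 1) ↦ E) ℂ) (x : E) :
    holPart φ (Complex.I • x) = Complex.I • holPart φ x := by
  ext w
  simp only [holPart, smul_apply, sub_apply, smul_eq_mul, smul_smul, Complex.I_mul_I, neg_smul,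
    one_smul, map_neg, neg_apply]
  linear_combination ((2⁻¹ : ℂ) * (φ.curryLeft (Complex.I • x)) w) * Complex.I_sq

/-- Hence `φ⁺(cx) = c φ⁺(x)` for every `c ∈ ℂ`. [folklore] -/
theorem holPart_smul (φ : MultilinearMap ℝ (fun _ : Fin (n + 1) ↦ E) ℂ) (c : ℂ)
    (x : E) : holPart φ (c • x) = c • holPart φ x := by
  conv_lhs => rw [← Complex.re_add_im c, add_smul, mul_smul, Complex.coe_smul, Complex.coe_smul,
    holPart_add, holPart_smul_real, holPart_smul_real, holPart_I_smul]
  conv_rhs => rw [← Complex.re_add_im c, add_smul, mul_smul]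

omit [NormedSpace ℂ E] in
/-- `z • y = (re z) • y + (im z) • (i y)` with real scalars on the right. [folklore] -/
theorem smul_eq_re_smul_add_im_smul {E : Type*} [AddCommGroup E] [Module ℂ E] (z : ℂ) (y : E) :
    z • y = z.re • y + z.im • (Complex.I • y) := by
  conv_lhs => rw [← Complex.re_add_im z]
  rw [add_smul, mul_smul, Complex.coe_smul, Complex.coe_smul]

/-- The weight identity in the first variable: `φ(y, e^{iθ}w) = e^{i(n+1)θ} φ(e^{-iθ}y, w)`.
[folklore] -/
theorem curryLeft_apply_rotate {φ : MultilinearMap ℝ (fun _ : Fin (n + 1) ↦ E) ℂ}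
    (hφ : HasDiagWeight (n + 1 : ℕ) φ) (θ : ℝ) (y : E) (w : Fin n → E) :
    φ.curryLeft y (fun i ↦ Complex.exp (θ * Complex.I) • w i) =
      Complex.exp (((n + 1 : ℕ) : ℤ) * θ * Complex.I) *
        φ.curryLeft (Complex.exp (-(θ * Complex.I)) • y) w := by
  have h := hφ θ (Fin.cons (Complex.exp (-(θ * Complex.I)) • y) w)
  have hc : (fun i : Fin (n + 1) ↦ Complex.exp (θ * Complex.I) •
      (Fin.cons (Complex.exp (-(θ * Complex.I)) • y) w : Fin (n + 1) → E) i) =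
      Fin.cons y (fun i ↦ Complex.exp (θ * Complex.I) • w i) := by
    funext i
    refine Fin.cases ?_ (fun j ↦ ?_) i
    · simp only [Fin.cons_zero, smul_smul, ← Complex.exp_add, add_neg_cancel, Complex.exp_zero,
        one_smul]
    · simp only [Fin.cons_succ]
  rw [hc] at h
  rw [MultilinearMap.curryLeft_apply, MultilinearMap.curryLeft_apply]
  exact h

/-- The real and imaginary parts of `e^{-iθ}` recombine to `e^{-iθ}` and to `e^{iθ}`. [folklore] -/
theorem exp_neg_mul_I_re_im (θ : ℝ) :
    ((Complex.exp (-(θ * Complex.I))).re : ℂ) + (Complex.exp (-(θ * Complex.I))).im * Complex.I =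
        Complex.exp (-(θ * Complex.I)) ∧
      ((Complex.exp (-(θ * Complex.I))).re : ℂ) - (Complex.exp (-(θ * Complex.I))).im * Complex.I =
        Complex.exp (θ * Complex.I) := by
  refine ⟨Complex.re_add_im _, ?_⟩
  have h : -(θ * Complex.I) = ((-θ : ℝ) : ℂ) * Complex.I := by push_cast; ring
  rw [h, Complex.exp_ofReal_mul_I_re, Complex.exp_ofReal_mul_I_im, Real.cos_neg, Real.sin_neg,
    Complex.exp_mul_I, ← Complex.ofReal_cos, ← Complex.ofReal_sin]
  push_cast
  ring

/-- Weights split: if `φ` has weight `n + 1`, then `φ⁺(x)` has weight `n` … [folklore] -/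
theorem hasDiagWeight_holPart {φ : MultilinearMap ℝ (fun _ : Fin (n + 1) ↦ E) ℂ}
    (hφ : HasDiagWeight (n + 1 : ℕ) φ) (x : E) : HasDiagWeight n (holPart φ x) := by
  intro θ w
  set z := Complex.exp (-(θ * Complex.I)) with hz
  set E₁ := Complex.exp (((n + 1 : ℕ) : ℤ) * θ * Complex.I) with hE₁
  have hE : E₁ * (z.re + z.im * Complex.I) = Complex.exp ((n : ℤ) * θ * Complex.I) := by
    rw [(exp_neg_mul_I_re_im θ).1, hE₁, ← Complex.exp_add]
    congr 1; push_cast; ring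
  have e1 : φ.curryLeft (z • x) = z.re • φ.curryLeft x + z.im • φ.curryLeft (Complex.I • x) := by
    rw [smul_eq_re_smul_add_im_smul, map_add, φ.curryLeft.map_smul, φ.curryLeft.map_smul]
  have e2 : φ.curryLeft (z • (Complex.I • x)) =
      z.re • φ.curryLeft (Complex.I • x) - z.im • φ.curryLeft x := by
    rw [smul_eq_re_smul_add_im_smul, smul_smul Complex.I Complex.I x, Complex.I_mul_I, neg_one_smul,
      map_add, φ.curryLeft.map_smul, φ.curryLeft.map_smul, map_neg, smul_neg, ← sub_eq_add_neg]
  simp only [holPart, smul_apply, sub_apply, smul_eq_mul]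
  rw [curryLeft_apply_rotate hφ θ x w, curryLeft_apply_rotate hφ θ (Complex.I • x) w, ← hz, e1, e2]
  simp only [add_apply, sub_apply, smul_apply, Complex.real_smul, ← hE₁]
  linear_combination (2⁻¹ * ((φ.curryLeft x) w - Complex.I * (φ.curryLeft (Complex.I • x)) w)) * hE +
    (2⁻¹ * E₁ * (z.im : ℂ) * (φ.curryLeft (Complex.I • x)) w) * Complex.I_sq

/-- … and `φ⁻(x)` has weight `n + 2`. [folklore] -/
theorem hasDiagWeight_antiPart {φ : MultilinearMap ℝ (fun _ : Fin (n + 1) ↦ E) ℂ}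
    (hφ : HasDiagWeight (n + 1 : ℕ) φ) (x : E) : HasDiagWeight (n + 2 : ℕ) (antiPart φ x) := by
  intro θ w
  set z := Complex.exp (-(θ * Complex.I)) with hz
  set E₁ := Complex.exp (((n + 1 : ℕ) : ℤ) * θ * Complex.I) with hE₁
  have hE : E₁ * (z.re - z.im * Complex.I) = Complex.exp (((n + 2 : ℕ) : ℤ) * θ * Complex.I) := by
    rw [(exp_neg_mul_I_re_im θ).2, hE₁, ← Complex.exp_add]
    congr 1; push_cast; ring
  have e1 : φ.curryLeft (z • x) = z.re • φ.curryLeft x + z.im • φ.curryLeft (Complex.I • x) := by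
    rw [smul_eq_re_smul_add_im_smul, map_add, φ.curryLeft.map_smul, φ.curryLeft.map_smul]
  have e2 : φ.curryLeft (z • (Complex.I • x)) =
      z.re • φ.curryLeft (Complex.I • x) - z.im • φ.curryLeft x := by
    rw [smul_eq_re_smul_add_im_smul, smul_smul Complex.I Complex.I x, Complex.I_mul_I, neg_one_smul,
      map_add, φ.curryLeft.map_smul, φ.curryLeft.map_smul, map_neg, smul_neg, ← sub_eq_add_neg]
  simp only [antiPart, smul_apply, add_apply, smul_eq_mul]
  rw [curryLeft_apply_rotate hφ θ x w, curryLeft_apply_rotate hφ θ (Complex.I • x) w, ← hz, e1, e2]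
  simp only [add_apply, sub_apply, smul_apply, Complex.real_smul, ← hE₁]
  linear_combination (2⁻¹ * ((φ.curryLeft x) w + Complex.I * (φ.curryLeft (Complex.I • x)) w)) * hE +
    (2⁻¹ * E₁ * (z.im : ℂ) * (φ.curryLeft (Complex.I • x)) w) * Complex.I_sq

/-- **An `ℝ`-multilinear map in `n` vector variables of diagonal weight `n` is `ℂ`-multilinear**
(the weight-`n` part of `⊗ⁿ (V^{1,0} ⊕ V^{0,1})*` is `⊗ⁿ V^{1,0 *}`; Huybrechts, Prop. 1.2.8).
Induction on `n` through `φ(x, ·) = φ⁺(x) + φ⁻(x)`: `φ⁻(x)` has weight `n + 1 > n - 1` in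
`n - 1` variables, hence vanishes. [cite: HuybrechtsCG2005, Prop. 1.2.8] -/
theorem map_update_smul_of_hasDiagWeight :
    ∀ {n : ℕ} (φ : MultilinearMap ℝ (fun _ : Fin n ↦ E) ℂ),
      HasDiagWeight n φ →
        ∀ (v : Fin n → E) (j : Fin n) (c : ℂ), φ (Function.update v j (c • v j)) = c * φ v
  | 0, _, _, _, j, _ => Fin.elim0 j
  | n + 1, φ, hφ, v, j, c => by
      -- `φ⁻ = 0`, so `φ(x, w) = φ⁺(x)(w)`
      have hanti : ∀ x, antiPart φ x = 0 := fun x ↦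
        eq_zero_of_hasDiagWeight_of_lt (hasDiagWeight_antiPart hφ x) (by omega)
      have hcurry : ∀ (x : E) (w : Fin n → E), φ (Fin.cons x w) = holPart φ x w := by
        intro x w
        rw [← MultilinearMap.curryLeft_apply, ← holPart_add_antiPart φ x, hanti x, add_zero]
      conv_lhs => rw [← Fin.cons_self_tail (Function.update v j (c • v j))]
      conv_rhs => rw [← Fin.cons_self_tail v]
      refine Fin.cases ?_ (fun i ↦ ?_) j
      · -- the first variable
        have htail : Fin.tail (Function.update v 0 (c • v 0)) = Fin.tail v := by
          funext i; simp [Fin.tail]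
        rw [htail, Function.update_self, hcurry, hcurry, holPart_smul φ]
        rfl
      · -- a later variable: induction hypothesis for `φ⁺(v 0)`
        have h0 : Function.update v i.succ (c • v i.succ) 0 = v 0 :=
          Function.update_of_ne (Fin.succ_ne_zero i).symm _ _
        have htail : Fin.tail (Function.update v i.succ (c • v i.succ)) =
            Function.update (Fin.tail v) i (c • Fin.tail v i) := by
          funext l
          by_cases hl : l = i
          · subst hl; simp [Fin.tail]
          · simp [Fin.tail, hl, (Fin.succ_injective n).ne hl]
        rw [h0, htail, hcurry, hcurry]
        exact map_update_smul_of_hasDiagWeight (holPart φ (v 0))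
          (hasDiagWeight_holPart hφ (v 0)) (Fin.tail v) i c

variable {M : Type v} [TopologicalSpace M] [ChartedSpace E M] {k : ℕ}

/-- **A form of type `(k,0)` is `ℂ`-multilinear** (Huybrechts, Prop. 1.2.8: the weight-`k` part of
`Λᵏ V*_ℂ` is `Λ^{k,0}`): the bridge from the tree's encoding `IsOfType k 0` of "holomorphic type"
to the classical pointwise one. [cite: HuybrechtsCG2005, Prop. 1.2.8] -/
theorem IsOfType.isComplexLinearForm {α : MForm 𝓘(ℝ, E) M ℂ k} (hα : IsOfType k 0 α) :
    IsComplexLinearForm α := by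
  intro x v j c
  have hw : HasDiagWeight k
      (show MultilinearMap ℝ (fun _ : Fin k ↦ E) ℂ from (α x).toMultilinearMap) := by
    intro θ w
    have h := hα.2 x θ (show Fin k → TangentSpace 𝓘(ℝ, E) x from w)
    simp only [Int.cast_natCast, Nat.cast_zero, sub_zero] at h
    exact h
  exact map_update_smul_of_hasDiagWeight _ hw (show Fin k → E from v) j c

/-- Type `(k,0)` is exactly `ℂ`-multilinearity. [cite: HuybrechtsCG2005, Prop. 1.2.8] -/
theorem isOfType_zero_iff_isComplexLinearForm {α : MForm 𝓘(ℝ, E) M ℂ k} :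
    IsOfType k 0 α ↔ IsComplexLinearForm α :=
  ⟨IsOfType.isComplexLinearForm, IsComplexLinearForm.isOfType⟩

end Bridge

end Literature.NumberTheory.Transcendental

end
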